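/-
Copyright (c) 2026 the pub-hodgecm-mathlib formalisation cell (harness21).  Dealer seat hodgecm-mathlib-LH4-plan (g10), req618 STAGE 1a «(D-RAM) FOUR-FRAME» squad
(director s1808∕s1809; LEAD T17-27 DIRECTIVE b9ecbbedecc9c5ae D1–D7 + T17-28 (D2′) SPLIT): the SUMMIT-SIDE sorry-free DEFS LEAF №1 of the line
`Cruxes/H413/Lines/F0_P3c_DyRamFourFrame.lean` — the IN-HOUSE CENSUS LAWS of the sheet of record and the (ii-0) foundation Props, as `def … : Prop` ONLY.  2026-09-03.
-/
import Literature.NumberTheory.Automorphic.UnitaryThreeFourFrameDefs        -- ★ g10-#0a: the sheet's §H tokens + D∕E∕P1∕P2 + §A (B-p04 (g61) a0c88f554182ea9d)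
import Literature.NumberTheory.Automorphic.UnitaryLatticeTreeFramesOfInvolution  -- ★ `isTree_latticeGraph_three_of_transitive` :266 (the (ii-0) currency; brings `SimpleGraph.IsTree`)
import HarnessLib

/-!
# F0 · P3c · line LH4 «(D-RAM) FOUR-FRAME» — DEFS LEAF №1: the census laws (S)(K-ABS)(K-SGN) of SIGSHEET v2, their place-wise cuts (S1) with `Iff.rfl` ties,
# the dyadic fence (S2), the laws-at-wild-places Prop, and the (ii-0) foundation Props `WildTransitivity` ∕ `WildTree`

Cell `pub/hodgecm-mathlib`, crux H413 = `stmt-HodgeConjecture-24833` (helper lane `--supports stmt-HodgeConjecture-24833 --as helper`), route HCCMUnconditional;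
dealer LH4-plan (g10) deal g10-#0b (WORD #2∕#3 2026-09-03), filed by LH4-p03 (g11).  DEF LANE (precedents ★ `Theorems/F0P3cStCharTSTorusDefs`, ★ `Theorems/F0P3bLocalAPacketsDefs`):
`def`s + `Iff.rfl`-grade ties ONLY; NO instance, NO notation, NO `sorry`, NO named fact, NO theorem asserting a law.  WHY A TREE MODULE (T11-93): a sorry-free support file
can conclude a statement BY NAME only if that statement lives in a sorry-free tree module — never in the sorried line file; the line file's §0 IMPORTS this leaf.

CONTENTS.  §S∕§K∕§L — the three CENSUS LAWS of the sheet of record `SIGSHEET-DRAM-FourFrame.v2` (LH4-plan (g9), sha16 c03c627160493264) VERBATIM (bodies byte-equal;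
GATE 1a-1 `LAWSOCKET-DRAM-FourFrame.v1` (F0P3a-p01 (g30), 69c2296bf1a50ec9) §0 carries the same bytes, REF1 (g33) m09 `blockcmp` 23∕23).  EACH LAW IS A CENSUS LAW OF RECORD
(memo (0b-i) v1.2 86c7f5a26f424de2 ∕ book «DRAM-LAW» v1.4 4b231cd3d1b58b69): an EMPIRICAL regularity of the fixed-vertex census of near-identity regular elements of `U(Φ₃)` at a
wild ramified quadratic datum, checked on 520∕520 tabulated values — NOT a literature fact, NOT asserted here, a PROVER TARGET (unit (iii) of the price sheet).  §1 — the
place-wise cuts `StableLawAt ∕ KappaAmplitudeLawAt ∕ KappaSignLawAt` (ref4 R4-68 (S1): v2's bodies behind `IsRamifiedQuadraticDatum σ ϖ d t →`, one datum at a time) with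
the DEFINITIONAL ties `…_iff_forall_at : Law ↔ ∀ data, LawAt` (`Iff.rfl`), and the dyadic fence `DyadicFence P := |2| < 1 → P` ((S2); GATE 1a-1 §1 VERBATIM).  §W — the laws
the line actually consumes: `FourFrameLawsWildAt N₀ τ σ ϖ d t` = the fenced conjunction of the three cuts at one datum, `FourFrameLawsWild N₀ τ` = at every complete datum with
finite residue field.  §T — the (ii-0) FOUNDATION in the abstract currency of ★ `isTree_latticeGraph_three_of_transitive` (`UnitaryLatticeTreeFramesOfInvolution` :266):
`WildTransitivityAt σ ϖ d t` = behind the datum and the fence, ITS TWO BINDERS `htr₀` (every self-dual vertex lattice is `u • 𝒪³`, `u ∈ U(σ, Φ₃)`) and `htr₂` (every type-2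
vertex lattice is `u • N₁`, `N₁ = latt diag(1,1,ϖ)`) VERBATIM — the heads dealt to LH4-p01 (g17) (htr₀-wild) and LH4-p02 (g12) (htr₂-wild); `WildTreeAt` = the tree conclusion
(★ :266 turns transitivity into the tree; the tame case `|2| = 1` is ★ `isTree_latticeGraph_three_tameRamifiedCM`).  PARAMETERS OF RECORD for the line: `N₀ = depthOfRecord`
(P1: 1∕3∕4 — the WEAKEST threshold the book states; the organ only needs SOME neighbourhood of `1`), `τ = tauOfRecord` (P2).  PLACE IN THE LINE (LEAD T17-29 (R-7),
directive v1.1 d3f1616d0136e728): every Prop here is a LAYER-2 target — concluded BY NAME by support theorems (`--supports stmt-HodgeConjecture-24833 --as helper`) and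
consumed by the per-piece row theorems; none of them is a registered stub of the skeleton (whose stubs are the per-piece slices of `AnchorRowsWild`, DEFS LEAF №2).

HONEST LABEL: HC_CM is proved only modulo the 7 printed citations (2 remaining: hLiu418 = stmt-HodgeConjecture-24832, h413 = stmt-HodgeConjecture-24833) until rung 0 closes;
this file asserts nothing (count-neutral vehicle, desk (P-1) «+0»).

## References
* [Rogawski1990] J. D. Rogawski, *Automorphic Representations of Unitary Groups in Three Variables*, Ann. of Math. Stud. 123 (1990): §4.9 pp. 55–57 (orbital integrals of
  near-identity elements as lattice counts), §12.2.
* [Kottwitz1986BaseChangeUnits] R. Kottwitz, *Base change for unit elements of Hecke algebras*, Compositio Math. 60 (1986), §3 (fixed-lattice counting).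
* [BruhatTits1972] F. Bruhat, J. Tits, *Groupes réductifs sur un corps local I*, Publ. Math. IHÉS 41 (1972), §10; [Tits1979] J. Tits, *Reductive groups over local fields*,
  Proc. Sympos. Pure Math. 33.1 (1979), §2.7 p. 48 ∕ §2.10 p. 49 (the building of a group of relative rank one is a tree; the quasi-split ramified `SU(3)`); [Jacobowitz1962] R. Jacobowitz, *Hermitian forms over local fields*, Amer. J. Math.
  84 (1962), §§9–11 (ramified dyadic unitary lattices).
-/

noncomputable section

namespace Summit.HodgeConjecture.HodgeConjecture.Cruxes.H413.F0P3cDyRamFourFrameLawDefs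

open scoped Valued WithZero Matrix MatrixGroups
open Finset Classical
open Literature.NumberTheory.Automorphic Literature.NumberTheory.Automorphic.HermitianLattice
  Literature.NumberTheory.Automorphic.UnitaryLatticeTree Literature.NumberTheory.Automorphic.UnitaryThreeFourFrame

/-! ## §S  The stable law (v1.4 §3 (S); desk price (iii)) — CENSUS LAW v1.4, empirical; a Prop, not a claim -/

/-- S · STABLE LAW, BOTH vertex types `t ∈ {0, 2}`: `Σ_b n_t(γ_b) = 4·(q^k − 1)∕(q − 1)` over `ℚ`, `k = (v_E(D_γ) + 2 − d)∕2`, i.e.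
`2k + d = n₁ + n₂ + n₃ + 2` (v1.4 §3; parity automatic on `E¹ ∩ (1+𝔭^d)`).  `N₀ : ℕ → ℕ` = the near-identity threshold schedule (P1).
CHECKED in these ℚ-tokens by LH4-plan (g9) against EVERY row of `F0P3a-p01/g28/law/frames.{p1,p1b,p1c,t3,t5,u1,u1b}.json` (S and K-ABS, both types,
`τ = tauOfRecord`): 520∕520 `(cell, row, stable|κ_i, type)` values (`LH4-plan/g9/lawcheck2.LH4plang9.txt`). -/
def StableLaw (N₀ : ℕ → ℕ) : Prop :=
  ∀ {K : Type} [Field K] [Valued K ℤᵐ⁰] [CompleteSpace K] [Fintype 𝓀[K]] (σ : K →+* K) (ϖ : K) (d t : ℕ),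
    IsRamifiedQuadraticDatum σ ϖ d t →
    ∀ (f : Fin 4 → Fin 3 → (Fin 3 → K)), IsFourFrameFamily σ f →
    ∀ (α β : K) (n₁ n₂ n₃ : ℕ), IsElementDatum σ ϖ (N₀ d) α β n₁ n₂ n₃ →
    ∀ (Γ : Fin 4 → GL (Fin 3) K), (∀ b, (Γ b : Matrix (Fin 3) (Fin 3) K) = frameElt σ f b α β) →
    ∀ (k : ℕ), 2 * k + d = n₁ + n₂ + n₃ + 2 →
    ∀ tv : ℕ, tv = 0 ∨ tv = 2 →
      ((∑ b : Fin 4, fixedVertexCount σ ϖ tv (Γ b) : ℕ) : ℚ) =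
        4 * ((Fintype.card 𝓀[K] : ℚ) ^ k - 1) / ((Fintype.card 𝓀[K] : ℚ) - 1)

/-! ## §K  The κ-law (v1.4 §3 (K) + SIGN + TYPE-2, §5; desk price (iii)) — CENSUS LAW v1.4, empirical; a Prop, not a claim

`B_i = (n_i − d)∕2 + 1 − v_E(2)` over `ℤ` (`2B_i = n_i − d + 2 − 2t`), amplitude `ampl q k B = 4(q^k − q^{k−B})⁺∕(q−1)` (H11);
TYPE 2: `B_i ↦ B_i + τ(d)` with `τ : ℕ → ℤ` an explicit schedule (P2 = v1.4's fitted `−1 ∕ −1 ∕ +1`), kept refutable. -/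

/-- K-ABS · κ-AMPLITUDE LAW (v1.4 §3 (K) "|κ_i| = 4(q^k − q^{k−B_i})⁺∕(q−1)", all near-identity regular `γ`, no roots needed):
`|Σ_b κ_i(b)·n_0(γ_b)| = ampl q k B_i` and `|Σ_b κ_i(b)·n_2(γ_b)| = ampl q k (B_i + τ d)` for each slot `i`.  (520∕520 with S, see S.)
UNTESTED beyond v1.4's cells: `e_F > 1` (`d ∈ {2,…,2e+1}` mixed parity vs `τ`), `q = 4`, equilateral wild keys — 0b's job. -/
def KappaAmplitudeLaw (N₀ : ℕ → ℕ) (τ : ℕ → ℤ) : Prop :=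
  ∀ {K : Type} [Field K] [Valued K ℤᵐ⁰] [CompleteSpace K] [Fintype 𝓀[K]] (σ : K →+* K) (ϖ : K) (d t : ℕ),
    IsRamifiedQuadraticDatum σ ϖ d t →
    ∀ (f : Fin 4 → Fin 3 → (Fin 3 → K)), IsFourFrameFamily σ f →
    ∀ (α β : K) (n₁ n₂ n₃ : ℕ), IsElementDatum σ ϖ (N₀ d) α β n₁ n₂ n₃ →
    ∀ (Γ : Fin 4 → GL (Fin 3) K), (∀ b, (Γ b : Matrix (Fin 3) (Fin 3) K) = frameElt σ f b α β) →
    ∀ (k : ℕ), 2 * k + d = n₁ + n₂ + n₃ + 2 →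
    ∀ (i : Fin 3) (B : ℤ), 2 * B = ((![n₁, n₂, n₃] : Fin 3 → ℕ) i : ℤ) - d + 2 - 2 * t →
      |((∑ b : Fin 4, kappaChar i b * (fixedVertexCount σ ϖ 0 (Γ b) : ℤ) : ℤ) : ℚ)| = ampl (Fintype.card 𝓀[K]) k B ∧
      |((∑ b : Fin 4, kappaChar i b * (fixedVertexCount σ ϖ 2 (Γ b) : ℤ) : ℤ) : ℚ)| = ampl (Fintype.card 𝓀[K]) k (B + τ d)

/-- K-SGN · κ-SIGN LAW (v1.4 §3 SIGN "sign = κ_i(b₀)·ω(Π_{j≠i} x_ij) with canonical roots", both vertex types): on the SQUARE family `γ = (a², b², 1)` with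
`a, b ∈ E¹` the CANONICAL roots (`v(a − 1) > v(2)`, i.e. deeper than `−a`; no loss near the identity since the squares of `E¹ ∩ (1+𝔭^{N₀})` form an open
subgroup), `l = (a, b, 1)`, `δ` skew:  `Σ_b κ_i(b)·n_t(γ_b) = κ_i(b₀)·ω(x_ij x_ik)·ampl q k (B_i [+ τ d])`, `κ_i(b₀) = baseSign = (1,1,ω(−1))_i`.
RE-VERIFIED by LH4-plan (g9) with exactly these tokens (κ-characters H5, base sign H6, F-parts H9–H10 with `δ = √D`) against
`F0P3a-p01/g28/law/frames.{p1,p1b,p1c,u1,u1b}.json` on every square row: 69∕69 non-zero type-0 and 36∕36 non-zero type-2 sums agree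
(`LH4-plan/g9/signcheck2.LH4plang9.txt`).  UNTESTED: type-2 sign when `B_i = 0`, `d` even (type-0 sum zero; never on square rows). -/
def KappaSignLaw (N₀ : ℕ → ℕ) (τ : ℕ → ℤ) : Prop :=
  ∀ {K : Type} [Field K] [Valued K ℤᵐ⁰] [CompleteSpace K] [Fintype 𝓀[K]] (σ : K →+* K) (ϖ : K) (d t : ℕ),
    IsRamifiedQuadraticDatum σ ϖ d t →
    ∀ (f : Fin 4 → Fin 3 → (Fin 3 → K)), IsFourFrameFamily σ f →
    ∀ (δ : K), σ δ = -δ → δ ≠ 0 →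
    ∀ (a b : K), a * σ a = 1 → b * σ b = 1 → Valued.v (a - 1) < Valued.v (2 : K) → Valued.v (b - 1) < Valued.v (2 : K) →
    ∀ (n₁ n₂ n₃ : ℕ), IsElementDatum σ ϖ (N₀ d) (a * a) (b * b) n₁ n₂ n₃ →
    ∀ (Γ : Fin 4 → GL (Fin 3) K), (∀ b', (Γ b' : Matrix (Fin 3) (Fin 3) K) = frameElt σ f b' (a * a) (b * b)) →
    ∀ (k : ℕ), 2 * k + d = n₁ + n₂ + n₃ + 2 →
    ∀ (i : Fin 3) (B : ℤ), 2 * B = ((![n₁, n₂, n₃] : Fin 3 → ℕ) i : ℤ) - d + 2 - 2 * t →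
      ((∑ b' : Fin 4, kappaChar i b' * (fixedVertexCount σ ϖ 0 (Γ b') : ℤ) : ℤ) : ℚ) =
          (baseSign σ i * normSign σ (fPartProd δ ![a, b, 1] i) : ℤ) * ampl (Fintype.card 𝓀[K]) k B ∧
      ((∑ b' : Fin 4, kappaChar i b' * (fixedVertexCount σ ϖ 2 (Γ b') : ℤ) : ℤ) : ℚ) =
          (baseSign σ i * normSign σ (fPartProd δ ![a, b, 1] i) : ℤ) * ampl (Fintype.card 𝓀[K]) k (B + τ d)

/-! ## §L  The law as one Prop, with v1.4's parameters of record and the data-backed alternative -/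

/-- L · THE FOUR-FRAME LAW AT Φ₃ with threshold schedule `N₀` and type-2 shift schedule `τ`: (S) ∧ (K-ABS) ∧ (K-SGN). -/
def FourFrameLawAtPhi3 (N₀ : ℕ → ℕ) (τ : ℕ → ℤ) : Prop := StableLaw N₀ ∧ KappaAmplitudeLaw N₀ τ ∧ KappaSignLaw N₀ τ

/-- L-REC · the law with v1.4's parameters of record: `d₀ = depthOfRecord` (1 ∕ 3 ∕ 4), `τ = tauOfRecord` (−1 ∕ −1 ∕ +1). -/
def FourFrameLawOfRecord : Prop := FourFrameLawAtPhi3 depthOfRecord tauOfRecord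

/-- L-ALT · LH4-plan's data-backed alternative threshold `N₀ = d` (all of `E¹ ∩ (1+𝔭_E^d)`; 6 extra R-U rows at `ℚ₂(i)` incl. `α = −1` fit), same `τ`. -/
def FourFrameLawDepthD : Prop := FourFrameLawAtPhi3 (fun d => d) tauOfRecord

/-! ## §1  The place-wise cuts (ref4 R4-68 (S1)) with `Iff.rfl` ties, and the dyadic fence (S2) — GATE 1a-1 §1 VERBATIM -/


/-- S-At · `StableLaw N₀` AT ONE DATUM `(K, σ, ϖ, d, t)`: v2's body behind `IsRamifiedQuadraticDatum σ ϖ d t →`, VERBATIM. -/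
def StableLawAt {K : Type} [Field K] [Valued K ℤᵐ⁰] [CompleteSpace K] [Fintype 𝓀[K]] (N₀ : ℕ → ℕ) (σ : K →+* K) (ϖ : K) (d t : ℕ) : Prop :=
    IsRamifiedQuadraticDatum σ ϖ d t →
    ∀ (f : Fin 4 → Fin 3 → (Fin 3 → K)), IsFourFrameFamily σ f →
    ∀ (α β : K) (n₁ n₂ n₃ : ℕ), IsElementDatum σ ϖ (N₀ d) α β n₁ n₂ n₃ →
    ∀ (Γ : Fin 4 → GL (Fin 3) K), (∀ b, (Γ b : Matrix (Fin 3) (Fin 3) K) = frameElt σ f b α β) →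
    ∀ (k : ℕ), 2 * k + d = n₁ + n₂ + n₃ + 2 →
    ∀ tv : ℕ, tv = 0 ∨ tv = 2 →
      ((∑ b : Fin 4, fixedVertexCount σ ϖ tv (Γ b) : ℕ) : ℚ) =
        4 * ((Fintype.card 𝓀[K] : ℚ) ^ k - 1) / ((Fintype.card 𝓀[K] : ℚ) - 1)

/-- K-ABS-At · `KappaAmplitudeLaw N₀ τ` at one datum, VERBATIM body. -/
def KappaAmplitudeLawAt {K : Type} [Field K] [Valued K ℤᵐ⁰] [CompleteSpace K] [Fintype 𝓀[K]] (N₀ : ℕ → ℕ) (τ : ℕ → ℤ) (σ : K →+* K) (ϖ : K) (d t : ℕ) : Prop :=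
    IsRamifiedQuadraticDatum σ ϖ d t →
    ∀ (f : Fin 4 → Fin 3 → (Fin 3 → K)), IsFourFrameFamily σ f →
    ∀ (α β : K) (n₁ n₂ n₃ : ℕ), IsElementDatum σ ϖ (N₀ d) α β n₁ n₂ n₃ →
    ∀ (Γ : Fin 4 → GL (Fin 3) K), (∀ b, (Γ b : Matrix (Fin 3) (Fin 3) K) = frameElt σ f b α β) →
    ∀ (k : ℕ), 2 * k + d = n₁ + n₂ + n₃ + 2 →
    ∀ (i : Fin 3) (B : ℤ), 2 * B = ((![n₁, n₂, n₃] : Fin 3 → ℕ) i : ℤ) - d + 2 - 2 * t →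
      |((∑ b : Fin 4, kappaChar i b * (fixedVertexCount σ ϖ 0 (Γ b) : ℤ) : ℤ) : ℚ)| = ampl (Fintype.card 𝓀[K]) k B ∧
      |((∑ b : Fin 4, kappaChar i b * (fixedVertexCount σ ϖ 2 (Γ b) : ℤ) : ℤ) : ℚ)| = ampl (Fintype.card 𝓀[K]) k (B + τ d)

/-- K-SGN-At · `KappaSignLaw N₀ τ` at one datum, VERBATIM body. -/
def KappaSignLawAt {K : Type} [Field K] [Valued K ℤᵐ⁰] [CompleteSpace K] [Fintype 𝓀[K]] (N₀ : ℕ → ℕ) (τ : ℕ → ℤ) (σ : K →+* K) (ϖ : K) (d t : ℕ) : Prop :=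
    IsRamifiedQuadraticDatum σ ϖ d t →
    ∀ (f : Fin 4 → Fin 3 → (Fin 3 → K)), IsFourFrameFamily σ f →
    ∀ (δ : K), σ δ = -δ → δ ≠ 0 →
    ∀ (a b : K), a * σ a = 1 → b * σ b = 1 → Valued.v (a - 1) < Valued.v (2 : K) → Valued.v (b - 1) < Valued.v (2 : K) →
    ∀ (n₁ n₂ n₃ : ℕ), IsElementDatum σ ϖ (N₀ d) (a * a) (b * b) n₁ n₂ n₃ →
    ∀ (Γ : Fin 4 → GL (Fin 3) K), (∀ b', (Γ b' : Matrix (Fin 3) (Fin 3) K) = frameElt σ f b' (a * a) (b * b)) →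
    ∀ (k : ℕ), 2 * k + d = n₁ + n₂ + n₃ + 2 →
    ∀ (i : Fin 3) (B : ℤ), 2 * B = ((![n₁, n₂, n₃] : Fin 3 → ℕ) i : ℤ) - d + 2 - 2 * t →
      ((∑ b' : Fin 4, kappaChar i b' * (fixedVertexCount σ ϖ 0 (Γ b') : ℤ) : ℤ) : ℚ) =
          (baseSign σ i * normSign σ (fPartProd δ ![a, b, 1] i) : ℤ) * ampl (Fintype.card 𝓀[K]) k B ∧
      ((∑ b' : Fin 4, kappaChar i b' * (fixedVertexCount σ ϖ 2 (Γ b') : ℤ) : ℤ) : ℚ) =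
          (baseSign σ i * normSign σ (fPartProd δ ![a, b, 1] i) : ℤ) * ampl (Fintype.card 𝓀[K]) k (B + τ d)

/-- (S1) tie · v2's closed `StableLaw` IS the conjunction of its place-wise cuts — `Iff.rfl`. -/
theorem stableLaw_iff_forall_at (N₀ : ℕ → ℕ) :
    StableLaw N₀ ↔ ∀ {K : Type} [Field K] [Valued K ℤᵐ⁰] [CompleteSpace K] [Fintype 𝓀[K]] (σ : K →+* K) (ϖ : K) (d t : ℕ), StableLawAt N₀ σ ϖ d t :=
  Iff.rfl

/-- (S1) tie · `KappaAmplitudeLaw` ↔ its place-wise cuts — `Iff.rfl`. -/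
theorem kappaAmplitudeLaw_iff_forall_at (N₀ : ℕ → ℕ) (τ : ℕ → ℤ) :
    KappaAmplitudeLaw N₀ τ ↔ ∀ {K : Type} [Field K] [Valued K ℤᵐ⁰] [CompleteSpace K] [Fintype 𝓀[K]] (σ : K →+* K) (ϖ : K) (d t : ℕ), KappaAmplitudeLawAt N₀ τ σ ϖ d t :=
  Iff.rfl

/-- (S1) tie · `KappaSignLaw` ↔ its place-wise cuts — `Iff.rfl`. -/
theorem kappaSignLaw_iff_forall_at (N₀ : ℕ → ℕ) (τ : ℕ → ℤ) :
    KappaSignLaw N₀ τ ↔ ∀ {K : Type} [Field K] [Valued K ℤᵐ⁰] [CompleteSpace K] [Fintype 𝓀[K]] (σ : K →+* K) (ϖ : K) (d t : ℕ), KappaSignLawAt N₀ τ σ ϖ d t :=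
  Iff.rfl

/-- (S2) fence · the DYADIC cut of a place-wise law: asked only where `|2| < 1` (the organ's range; odd-`p` tame and equal-characteristic corners of the datum excluded). -/
def DyadicFence {K : Type} [Field K] [Valued K ℤᵐ⁰] (P : Prop) : Prop := Valued.v (2 : K) < 1 → P

/-- (S2) · a closed law implies its fenced place-wise cut (the fence only weakens). -/
theorem dyadicFence_of {K : Type} [Field K] [Valued K ℤᵐ⁰] {P : Prop} (h : P) : DyadicFence (K := K) P := fun _ => h


/-! ## §W  The laws the line consumes: the fenced conjunction of the three cuts, at one datum and at every datum -/

/-- W-At · THE FOUR-FRAME LAWS AT ONE WILD DATUM `(K, σ, ϖ, d, t)`: behind the dyadic fence `|2| < 1` (S2), the conjunction (S)At ∧ (K-ABS)At ∧ (K-SGN)At of §1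
(each already behind `IsRamifiedQuadraticDatum σ ϖ d t →`).  CENSUS LAW OF RECORD (memo (0b-i) v1.2 86c7f5a26f424de2 ∕ book v1.4 4b231cd3d1b58b69) — NOT a literature fact,
a PROVER TARGET (unit (iii)); a `Prop`, nothing asserted. -/
def FourFrameLawsWildAt {K : Type} [Field K] [Valued K ℤᵐ⁰] [CompleteSpace K] [Fintype 𝓀[K]] (N₀ : ℕ → ℕ) (τ : ℕ → ℤ) (σ : K →+* K) (ϖ : K) (d t : ℕ) : Prop :=
    DyadicFence (K := K) (StableLawAt N₀ σ ϖ d t ∧ KappaAmplitudeLawAt N₀ τ σ ϖ d t ∧ KappaSignLawAt N₀ τ σ ϖ d t)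

/-- W · THE FOUR-FRAME LAWS AT EVERY WILD DATUM (complete `K`, finite residue field): `∀ data, FourFrameLawsWildAt`.  The line's unit-(iii) stub is this Prop at the
parameters of record `(depthOfRecord, tauOfRecord)`.  CENSUS LAW OF RECORD — NOT a literature fact, a PROVER TARGET; nothing asserted. -/
def FourFrameLawsWild (N₀ : ℕ → ℕ) (τ : ℕ → ℤ) : Prop :=
    ∀ {K : Type} [Field K] [Valued K ℤᵐ⁰] [CompleteSpace K] [Fintype 𝓀[K]] (σ : K →+* K) (ϖ : K) (d t : ℕ), FourFrameLawsWildAt N₀ τ σ ϖ d t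

/-- W · the closed laws of v2 imply the wild conjunction (the fence and the cut only weaken) — `Iff.rfl`-grade glue, by the three (S1) ties. -/
theorem fourFrameLawsWild_of_laws (N₀ : ℕ → ℕ) (τ : ℕ → ℤ) (hS : StableLaw N₀) (hKA : KappaAmplitudeLaw N₀ τ) (hKS : KappaSignLaw N₀ τ) :
    FourFrameLawsWild N₀ τ :=
  fun σ ϖ d t => dyadicFence_of ⟨hS σ ϖ d t, hKA σ ϖ d t, hKS σ ϖ d t⟩

/-- (iii-rec) the fenced wild laws AT THE PARAMETERS OF RECORD `(N₀, τ) := (depthOfRecord, tauOfRecord)` (★ #0a P1∕P2: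
`N₀(d) = d + 1 − (d mod 2)`, `τ(d) = 2·(d mod 2) − 1`) — the closed Prop the line's layer-2 law theorems conclude BY NAME.
Census law of record (memo v1.2 86c7f5a26f424de2 ∕ book v1.4 4b231cd3d1b58b69), NOT a literature fact, a PROVER TARGET. -/
def FourFrameLawsWildOfRecord : Prop := FourFrameLawsWild depthOfRecord tauOfRecord

/-- (iii-rec) · v2's closed law of record `FourFrameLawOfRecord` (★ sheet §L, parameters `(depthOfRecord, tauOfRecord)`) implies the fenced wild laws of record —
`fourFrameLawsWild_of_laws` at the parameters of record (the fence and the cuts only weaken). -/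
theorem fourFrameLawsWildOfRecord_of_lawOfRecord (h : FourFrameLawOfRecord) : FourFrameLawsWildOfRecord :=
  fourFrameLawsWild_of_laws depthOfRecord tauOfRecord h.1 h.2.1 h.2.2

/-! ## §T  The (ii-0) foundation: transitivity of `U(σ, Φ₃)` on the two vertex types at a wild datum (the `htr₀`∕`htr₂` binders of ★ :266 VERBATIM), and the tree -/

/-- T-At · WILD TRANSITIVITY AT ONE DATUM: behind `IsRamifiedQuadraticDatum σ ϖ d t` and the fence `|2| < 1`, the two binders of ★ `isTree_latticeGraph_three_of_transitive`
VERBATIM — `htr₀`: every self-dual vertex lattice of `(K³, Φ₃)` is `u • 𝒪³` for some `u ∈ U(σ, Φ₃)`; `htr₂`: every type-2 vertex lattice is `u • latt diag(1, 1, ϖ)`.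
Unit (ii-0) of the price sheet (LHref-N #271 (A)(B) proof plan; tame `|2| = 1` twins ★ `exists_unitary_mapGL_stdLattice_eq_of_isSelfDualLattice_of_v_two` ∕
★ `forall_isVertexLattice_two_exists_mapGL_N₁_eq_of_neg`).  A PROVER TARGET; nothing asserted. [cite: Jacobowitz1962, §§9–11] [cite: BruhatTits1972, §10] -/
def WildTransitivityAt {K : Type} [Field K] [Valued K ℤᵐ⁰] [CompleteSpace K] [Fintype 𝓀[K]] (σ : K →+* K) (ϖ : K) (d t : ℕ) : Prop :=
    IsRamifiedQuadraticDatum σ ϖ d t → Valued.v (2 : K) < 1 →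
      (∀ L : Submodule 𝒪[K] (Fin 3 → K), IsSelfDualLattice σ ϖ ((StdForm.antidiagonal 3).over K) L →
        ∃ u : unitaryGroupOfForm σ ((StdForm.antidiagonal 3).over K), L = mapGL (u : GL (Fin 3) K) (stdLattice K 3)) ∧
      (∀ M : Submodule 𝒪[K] (Fin 3 → K), IsVertexLattice σ ϖ ((StdForm.antidiagonal 3).over K) 2 M →
        ∃ u : unitaryGroupOfForm σ ((StdForm.antidiagonal 3).over K), M = mapGL (u : GL (Fin 3) K) (latt (Matrix.diagonal ![(1 : K), 1, ϖ])))

/-- T · WILD TRANSITIVITY at every complete datum with finite residue field.  The line's unit-(ii-0) stub is this Prop; consumed by the census dictionary (ii-G)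
(`G ∕ K_t` = the type-`t` vertices) and by the rank layer.  A PROVER TARGET (in print: Jacobowitz 1962 §§9–11 — kept a summit-side target here, no cite token,
so the gate does not read this parameter-free `Prop` as an inline literature fact); nothing asserted. -/
def WildTransitivity : Prop :=
    ∀ {K : Type} [Field K] [Valued K ℤᵐ⁰] [CompleteSpace K] [Fintype 𝓀[K]] (σ : K →+* K) (ϖ : K) (d t : ℕ), WildTransitivityAt σ ϖ d t

/-- T′-At · THE WILD LATTICE GRAPH IS A TREE at one datum (behind the datum and the fence): the conclusion of ★ :266.  From `WildTransitivityAt` by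
★ `isTree_latticeGraph_three_of_transitive` (a support theorem, not restated here).  A PROVER TARGET; nothing asserted. [cite: Tits1979, §2.7 (p. 48)] [cite: Serre1980Trees, II.1.1] -/
def WildTreeAt {K : Type} [Field K] [Valued K ℤᵐ⁰] [CompleteSpace K] [Fintype 𝓀[K]] (σ : K →+* K) (ϖ : K) (d t : ℕ) : Prop :=
    IsRamifiedQuadraticDatum σ ϖ d t → Valued.v (2 : K) < 1 → (latticeGraph σ ϖ ((StdForm.antidiagonal 3).over K)).IsTree

/-- T′ · the wild tree at every complete datum with finite residue field (in print: Tits 1979 §2.7 p. 48 — kept a summit-side target here, no cite token, so the gate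
does not read this parameter-free `Prop` as an inline literature fact).  Nothing asserted. -/
def WildTree : Prop :=
    ∀ {K : Type} [Field K] [Valued K ℤᵐ⁰] [CompleteSpace K] [Fintype 𝓀[K]] (σ : K →+* K) (ϖ : K) (d t : ℕ), WildTreeAt σ ϖ d t

end Summit.HodgeConjecture.HodgeConjecture.Cruxes.H413.F0P3cDyRamFourFrameLawDefs

end
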